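import Summits.NavierStokesRegularity.NavierStokesRegularity.Theses.RellichScar
import Summits.NavierStokesRegularity.NavierStokesRegularity.Theorems.ScarRigidity.Negative.LogicAndLoadBearing
import Literature.Analysis.FluidPDE.TypeIAncientMild
import Literature.Analysis.FluidPDE.ParasiticSlabFlow
import Literature.Analysis.FluidPDE.SpaceTimeCalculus
import Mathlib.Analysis.SpecialFunctions.JapaneseBracket
import HarnessLib

/-!
# `ScarRigidity` — line `finite-energy-log-convexity`, stub `stub_logConvexityBelowThreshold`:
# the `L²` energy of the difference of two apex profiles is differentiable in time
# (crux stmt-NavierStokesRegularity-11717)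

Helper file 3 of S4 (`stub_logConvexityBelowThreshold`): the first (and `ψ`-free) entry of the
energy package `stub_coulombEnergyPackage`. For two jointly smooth fields `V₁, V₂` on the open
slab `t < 0` with the apex bound `‖Vᵢ(t,x)‖ ≤ C/(‖x‖ + √(-t))` (`HasTypeIDecay`), the time-derivative
bounds `‖∂ₜVᵢ‖ ≤ Lᵢ/(‖x‖ + √(-t))³` of S1β and the twin majorant `‖V₁ - V₂‖ ≤ K'(-t)/(‖x‖ + √(-t))³`
of S2, the `L²` energy `b(t) = ∫ ‖(V₁ - V₂)(t, x)‖² dx` of `w = V₁ - V₂` is differentiable at every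
`t < 0` with

  `b'(t) = ∫ 2 ⟪w(t, x), ∂ₜw(t, x)⟫ dx`,  `∂ₜw(t, x) = ∂ₜV₁(t, x) - ∂ₜV₂(t, x)`

(`hasDerivAt_integral_norm_sq_sub`; differentiation under the integral sign, Mathlib
`hasDerivAt_integral_of_dominated_loc_of_deriv_le`, dominated on the time window `(2t, t/2)` by
`4C(|L₁| + |L₂|)/(‖x‖ + √(-t/2))⁴ ∈ L¹(ℝ³)`). The weights `(‖x‖ + a)^{-p}`, `a > 0`, `p > 3`, are
integrable on `ℝ³` (`integrable_inv_norm_add_pow`, from Mathlib `integrable_one_add_norm`).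
-/

noncomputable section

open Set Filter Function MeasureTheory Metric TopologicalSpace
open scoped Topology ENNReal NNReal InnerProductSpace RealInnerProductSpace
open Literature.Analysis.FluidPDE
open Summit.NavierStokesRegularity.NavierStokesRegularity.Theses.RellichScar
open Summit.NavierStokesRegularity.NavierStokesRegularity.Theorems.ScarRigidity.Negative

set_option linter.dupNamespace false

namespace Summit.NavierStokesRegularity.NavierStokesRegularity.Theorems.RellichScarScarRigidity

/-! ## Integrable apex weights -/

/-- `(‖x‖ + a)⁻¹ ≤ (min 1 a)⁻¹ (1 + ‖x‖)⁻¹`-type comparison: `min 1 a · (1 + ‖x‖) ≤ ‖x‖ + a`. [folklore] -/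
theorem min_one_mul_one_add_norm_le {E : Type*} [NormedAddCommGroup E] (a : ℝ) (x : E) :
    min 1 a * (1 + ‖x‖) ≤ ‖x‖ + a := by
  have h1 : min 1 a ≤ 1 := min_le_left _ _
  have h2 : min 1 a ≤ a := min_le_right _ _
  nlinarith [norm_nonneg x]

/-- **The apex weights are integrable**: `x ↦ ((‖x‖ + a)^p)⁻¹ ∈ L¹(ℝ³)` for `a > 0` and a natural
number `p > 3` (comparison with `(1 + ‖x‖)^{-p}`, Mathlib `integrable_one_add_norm`). [folklore] -/
theorem integrable_inv_norm_add_pow {a : ℝ} (ha : 0 < a) {p : ℕ} (hp : 3 < p) :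
    Integrable (fun x : EuclideanSpace ℝ (Fin 3) => ((‖x‖ + a) ^ p)⁻¹) volume := by
  have hm : 0 < min 1 a := lt_min one_pos ha
  have hr : (Module.finrank ℝ (EuclideanSpace ℝ (Fin 3)) : ℝ) < (p : ℝ) := by
    rw [finrank_euclideanSpace, Fintype.card_fin]; exact_mod_cast hp
  have hint := (integrable_one_add_norm (μ := (volume : Measure (EuclideanSpace ℝ (Fin 3)))) hr).const_mul
    ((min 1 a) ^ p)⁻¹
  refine hint.mono' ?_ (ae_of_all _ fun x => ?_)
  · exact ((continuous_norm.add continuous_const).pow p).inv₀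
      (fun x => (pow_pos (add_pos_of_nonneg_of_pos (norm_nonneg _) ha) p).ne') |>.aestronglyMeasurable
  · have hpos : 0 < ‖x‖ + a := add_pos_of_nonneg_of_pos (norm_nonneg _) ha
    have h1 : 0 < 1 + ‖x‖ := by positivity
    rw [Real.norm_of_nonneg (inv_nonneg.2 (pow_nonneg hpos.le p)), Real.rpow_neg h1.le,
      Real.rpow_natCast, ← mul_inv, ← mul_pow]
    exact inv_anti₀ (pow_pos (mul_pos hm h1) p)
      (pow_le_pow_left₀ (mul_pos hm h1).le (min_one_mul_one_add_norm_le a x) p)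

/-- Monotonicity of the apex weight in the regularising length: for `a ≤ b` (`0 < a`),
`K/(‖x‖ + b)^p ≤ |K|/(‖x‖ + a)^p`. [folklore] -/
theorem div_norm_add_pow_le {E : Type*} [NormedAddCommGroup E] {a b K : ℝ} (ha : 0 < a)
    (hab : a ≤ b) (p : ℕ) (x : E) : K / (‖x‖ + b) ^ p ≤ |K| / (‖x‖ + a) ^ p := by
  have hxa : 0 < ‖x‖ + a := add_pos_of_nonneg_of_pos (norm_nonneg _) ha
  have hxb : 0 < ‖x‖ + b := by linarith
  calc K / (‖x‖ + b) ^ p ≤ |K| / (‖x‖ + b) ^ p :=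
        div_le_div_of_nonneg_right (le_abs_self K) (pow_nonneg hxb.le p)
    _ ≤ |K| / (‖x‖ + a) ^ p := by
        apply div_le_div_of_nonneg_left (abs_nonneg K) (pow_pos hxa p)
        exact pow_le_pow_left₀ hxa.le (by linarith) p

/-! ## The `L²` energy of the difference -/

/-- **The `L²` energy of the difference is differentiable in time.** For jointly smooth `V₁, V₂`
on `t < 0` with the apex bound at constant `C`, `‖∂ₜVᵢ‖ ≤ Lᵢ/(‖x‖ + √(-t))³` and
`‖V₁ - V₂‖ ≤ K'(-t)/(‖x‖ + √(-t))³`: at every `t < 0` the integrand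
`2⟪w(t,x), ∂ₜw(t,x)⟫` is integrable and `s ↦ ∫ ‖(V₁ - V₂)(s, x)‖² dx` has derivative
`∫ 2⟪w(t,x), ∂ₜw(t,x)⟫ dx` (differentiation under the integral sign on the window `(2t, t/2)`,
dominated by `4C(|L₁|+|L₂|)/(‖x‖ + √(-t/2))⁴`). [folklore] -/
theorem hasDerivAt_integral_norm_sq_sub
    {V₁ V₂ : ℝ → EuclideanSpace ℝ (Fin 3) → EuclideanSpace ℝ (Fin 3)} {C L₁ L₂ K' : ℝ}
    (hV₁ : IsSmoothSpaceTimeOn (Iio (0 : ℝ)) V₁) (hV₂ : IsSmoothSpaceTimeOn (Iio (0 : ℝ)) V₂)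
    (hd₁ : HasTypeIDecay C V₁) (hd₂ : HasTypeIDecay C V₂)
    (ht₁ : ∀ t < 0, ∀ x : EuclideanSpace ℝ (Fin 3),
      ‖deriv (fun s => V₁ s x) t‖ ≤ L₁ / (‖x‖ + Real.sqrt (-t)) ^ 3)
    (ht₂ : ∀ t < 0, ∀ x : EuclideanSpace ℝ (Fin 3),
      ‖deriv (fun s => V₂ s x) t‖ ≤ L₂ / (‖x‖ + Real.sqrt (-t)) ^ 3)
    (hw : ∀ t < 0, ∀ x : EuclideanSpace ℝ (Fin 3),
      ‖V₁ t x - V₂ t x‖ ≤ K' * (-t) / (‖x‖ + Real.sqrt (-t)) ^ 3)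
    {t : ℝ} (ht : t < 0) :
    Integrable (fun x : EuclideanSpace ℝ (Fin 3) => 2 * ⟪V₁ t x - V₂ t x,
        deriv (fun s => V₁ s x) t - deriv (fun s => V₂ s x) t⟫) volume ∧
      HasDerivAt (fun s => ∫ x, ‖V₁ s x - V₂ s x‖ ^ 2)
        (∫ x, 2 * ⟪V₁ t x - V₂ t x, deriv (fun s => V₁ s x) t - deriv (fun s => V₂ s x) t⟫) t := by
  have hC : 0 ≤ C := nonneg_of_hasTypeIDecay hd₁
  -- the time window `(2t, t/2)` and the regularising length `c₀ = √(-t/2)`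
  set c₀ : ℝ := Real.sqrt (-t / 2) with hc₀_def
  have hc₀ : 0 < c₀ := Real.sqrt_pos.2 (by linarith)
  have hwin : Ioo (2 * t) (t / 2) ∈ 𝓝 t := Ioo_mem_nhds (by linarith) (by linarith)
  have hneg : ∀ s ∈ Ioo (2 * t) (t / 2), s < 0 := fun s hs => by linarith [hs.2]
  have hsqrt : ∀ s ∈ Ioo (2 * t) (t / 2), c₀ ≤ Real.sqrt (-s) := fun s hs =>
    Real.sqrt_le_sqrt (by linarith [hs.2])
  -- names
  set w : ℝ → EuclideanSpace ℝ (Fin 3) → EuclideanSpace ℝ (Fin 3) := fun s x => V₁ s x - V₂ s x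
    with hw_def
  set D : ℝ → EuclideanSpace ℝ (Fin 3) → EuclideanSpace ℝ (Fin 3) :=
    fun s x => deriv (fun s => V₁ s x) s - deriv (fun s => V₂ s x) s with hD_def
  have hwsm : IsSmoothSpaceTimeOn (Iio (0 : ℝ)) w := hV₁.sub hV₂
  have hDsm : IsSmoothSpaceTimeOn (Iio (0 : ℝ)) D :=
    (hV₁.isSmoothSpaceTimeOn_deriv isOpen_Iio).sub (hV₂.isSmoothSpaceTimeOn_deriv isOpen_Iio)
  -- pointwise time derivative of `‖w‖²`
  have hdiff : ∀ x, ∀ s ∈ Ioo (2 * t) (t / 2),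
      HasDerivAt (fun s => ‖w s x‖ ^ 2) (2 * ⟪w s x, D s x⟫) s := by
    intro x s hs
    have h1 : HasDerivAt (fun s => w s x) (D s x) s :=
      (hV₁.hasDerivAt_timeLine isOpen_Iio (hneg s hs) x).sub
        (hV₂.hasDerivAt_timeLine isOpen_Iio (hneg s hs) x)
    exact h1.norm_sq
  -- the dominating function
  set bound : EuclideanSpace ℝ (Fin 3) → ℝ :=
    fun x => 4 * C * (|L₁| + |L₂|) * ((‖x‖ + c₀) ^ 4)⁻¹ with hbound_def
  have hbound_int : Integrable bound volume :=
    (integrable_inv_norm_add_pow hc₀ (by norm_num : 3 < 4)).const_mul _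
  have hbound : ∀ x, ∀ s ∈ Ioo (2 * t) (t / 2), ‖2 * ⟪w s x, D s x⟫‖ ≤ bound x := by
    intro x s hs
    have hs0 := hneg s hs
    have hxc : 0 < ‖x‖ + c₀ := add_pos_of_nonneg_of_pos (norm_nonneg _) hc₀
    -- `‖w‖ ≤ 2C/(‖x‖ + c₀)`
    have hw1 : ‖w s x‖ ≤ 2 * C / (‖x‖ + c₀) := by
      have h1 := hd₁ s hs0 x
      have h2 := hd₂ s hs0 x
      have h3 : C / (‖x‖ + Real.sqrt (-s)) ≤ C / (‖x‖ + c₀) :=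
        div_le_div_of_nonneg_left hC hxc (by linarith [hsqrt s hs])
      calc ‖w s x‖ ≤ ‖V₁ s x‖ + ‖V₂ s x‖ := norm_sub_le _ _
        _ ≤ 2 * C / (‖x‖ + c₀) := by rw [two_mul, add_div]; linarith
    -- `‖D‖ ≤ (|L₁| + |L₂|)/(‖x‖ + c₀)³`
    have hD1 : ‖D s x‖ ≤ (|L₁| + |L₂|) / (‖x‖ + c₀) ^ 3 := by
      have h1 := (ht₁ s hs0 x).trans (div_norm_add_pow_le hc₀ (hsqrt s hs) 3 x)
      have h2 := (ht₂ s hs0 x).trans (div_norm_add_pow_le hc₀ (hsqrt s hs) 3 x)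
      calc ‖D s x‖ ≤ ‖deriv (fun s => V₁ s x) s‖ + ‖deriv (fun s => V₂ s x) s‖ := norm_sub_le _ _
        _ ≤ (|L₁| + |L₂|) / (‖x‖ + c₀) ^ 3 := by rw [add_div]; linarith
    have hinner : |⟪w s x, D s x⟫| ≤ ‖w s x‖ * ‖D s x‖ := abs_real_inner_le_norm _ _
    have hprod : ‖w s x‖ * ‖D s x‖ ≤ 2 * C / (‖x‖ + c₀) * ((|L₁| + |L₂|) / (‖x‖ + c₀) ^ 3) :=
      mul_le_mul hw1 hD1 (norm_nonneg _) (by positivity)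
    rw [Real.norm_eq_abs, abs_mul, abs_two]
    calc 2 * |⟪w s x, D s x⟫| ≤ 2 * (2 * C / (‖x‖ + c₀) * ((|L₁| + |L₂|) / (‖x‖ + c₀) ^ 3)) := by
          linarith
      _ = bound x := by simp only [hbound_def]; field_simp; ring
  -- integrability of `‖w(t)‖²`
  have hint : Integrable (fun x => ‖w t x‖ ^ 2) volume := by
    have hct : 0 < Real.sqrt (-t) := Real.sqrt_pos.2 (by linarith)
    have hmaj := (integrable_inv_norm_add_pow hct (by norm_num : 3 < 6)).const_mul ((K' * (-t)) ^ 2)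
    refine hmaj.mono' ((hwsm.contDiff_slice ht).continuous.norm.pow 2).aestronglyMeasurable
      (ae_of_all _ fun x => ?_)
    have hxc : 0 < ‖x‖ + Real.sqrt (-t) := add_pos_of_nonneg_of_pos (norm_nonneg _) hct
    rw [Real.norm_of_nonneg (sq_nonneg _)]
    have h1 : ‖w t x‖ ≤ K' * (-t) / (‖x‖ + Real.sqrt (-t)) ^ 3 := hw t ht x
    have h0 : 0 ≤ ‖w t x‖ := norm_nonneg _
    calc ‖w t x‖ ^ 2 ≤ (K' * (-t) / (‖x‖ + Real.sqrt (-t)) ^ 3) ^ 2 := pow_le_pow_left₀ h0 h1 2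
      _ = (K' * (-t)) ^ 2 * ((‖x‖ + Real.sqrt (-t)) ^ 6)⁻¹ := by field_simp
  -- differentiation under the integral sign
  have hmeas : ∀ᶠ s in 𝓝 t, AEStronglyMeasurable (fun x => ‖w s x‖ ^ 2) volume :=
    Filter.eventually_of_mem hwin fun s hs =>
      ((hwsm.contDiff_slice (hneg s hs)).continuous.norm.pow 2).aestronglyMeasurable
  have hmeas' : AEStronglyMeasurable (fun x => 2 * ⟪w t x, D t x⟫) volume :=
    (((hwsm.contDiff_slice ht).continuous.inner (hDsm.contDiff_slice ht).continuous).const_mul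
      2).aestronglyMeasurable
  exact hasDerivAt_integral_of_dominated_loc_of_deriv_le (μ := volume)
    (F := fun s x => ‖w s x‖ ^ 2) (F' := fun s x => 2 * ⟪w s x, D s x⟫) (x₀ := t) hwin
    hmeas hint hmeas' (ae_of_all _ hbound) hbound_int (ae_of_all _ hdiff)

/-! ## Registered sub-goal (helper stub of `stub_logConvexityBelowThreshold`) -/

/-- **Registered helper stub `stub_l2EnergyDerivative`** (crux stmt-NavierStokesRegularity-11717,
line `finite-energy-log-convexity`, helper of S4): differentiability in time of the `L²` energy of
the difference of two apex profiles, as registered. [folklore] -/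
theorem stub_l2EnergyDerivative :
    ∀ (V₁ V₂ : ℝ → EuclideanSpace ℝ (Fin 3) → EuclideanSpace ℝ (Fin 3)) (C L₁ L₂ K' t : ℝ),
      IsSmoothSpaceTimeOn (Iio (0 : ℝ)) V₁ → IsSmoothSpaceTimeOn (Iio (0 : ℝ)) V₂ →
      HasTypeIDecay C V₁ → HasTypeIDecay C V₂ →
      (∀ t < 0, ∀ x : EuclideanSpace ℝ (Fin 3),
        ‖deriv (fun s => V₁ s x) t‖ ≤ L₁ / (‖x‖ + Real.sqrt (-t)) ^ 3) →
      (∀ t < 0, ∀ x : EuclideanSpace ℝ (Fin 3),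
        ‖deriv (fun s => V₂ s x) t‖ ≤ L₂ / (‖x‖ + Real.sqrt (-t)) ^ 3) →
      (∀ t < 0, ∀ x : EuclideanSpace ℝ (Fin 3),
        ‖V₁ t x - V₂ t x‖ ≤ K' * (-t) / (‖x‖ + Real.sqrt (-t)) ^ 3) →
      t < 0 →
      Integrable (fun x : EuclideanSpace ℝ (Fin 3) => 2 * ⟪V₁ t x - V₂ t x,
          deriv (fun s => V₁ s x) t - deriv (fun s => V₂ s x) t⟫) volume ∧
        HasDerivAt (fun s => ∫ x, ‖V₁ s x - V₂ s x‖ ^ 2)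
          (∫ x, 2 * ⟪V₁ t x - V₂ t x, deriv (fun s => V₁ s x) t - deriv (fun s => V₂ s x) t⟫) t :=
  fun _V₁ _V₂ _C _L₁ _L₂ _K' _t hV₁ hV₂ hd₁ hd₂ ht₁ ht₂ hw ht =>
    hasDerivAt_integral_norm_sq_sub hV₁ hV₂ hd₁ hd₂ ht₁ ht₂ hw ht

end Summit.NavierStokesRegularity.NavierStokesRegularity.Theorems.RellichScarScarRigidity

end
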